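/-
Copyright: statement-level skeleton of a published paper (lit-balaban cell, Phase-2 proof seat p25, gen 20). No proof
claims beyond what the kernel checks below.
-/
import Literature.MathematicalPhysics.QuantumFieldTheory.BalabanImbrieJaffe1984to88.BIJ88WalkIneq312RemainderBeat

/-!
# `BalabanImbrieJaffe1984to88.BIJ88WalkRemainderBeatCurrency312` — T. Bałaban, J. Imbrie, A. Jaffe, *Effective action
and cluster properties of the abelian Higgs model*, Commun. Math. Phys. **114** (1988) 257–315 [BalabanImbrieJaffe1988],
§5.14 p. 312 [PDF 56], verbatim (x2 render `lit-balaban-r16/renders/cmp114/original-p056-x2.png`, re-read this session):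
*"The main source of concern in estimating G_k(X_{r′}) is that we only have bounds |F_{k,loc}(X_{σ_1})| ≦
c(L^kε)^{−m(c)}e^{−m′(c)}, coming from our estimates on perturbation expansions of observables; similarly for
F^L_{k+1,loc}(X_c). Here m(c), m′(c) depend on the terms in F in X_{σ_1} or X_c. By performing sufficiently many
integrations by parts, we have arranged for enough small factors to beat these large factors in the remainder terms (at
least if X_{r′} is not at the boundary of Λ₁₂^{(k)})."*, and p. 309 [PDF 53] (x2 render `…-p053-x2.png`): *"Each factor
V^{(k)}(Y) in Π_{j∈H_β}(d/dt)_{γ_j} produces a factor e^β(L^kε/ε₀)^{1/4−α} in the final estimate."* — **THE BEATING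
CLAUSE IN PRINT'S CURRENCY: HOW MANY INTEGRATIONS BY PARTS ARE "SUFFICIENTLY MANY"** (p25 gen 20; a MEMBER of row
C2.Claim@312, head theorem of record `BIJ88WalkIneq312RemainderBdry.ineq312_remainder_bdry` UNCHANGED and USED BY NAME
through its closed-form corollary `BIJ88WalkIneq312RemainderBeat.ineq312_remainder_bdry_global`).

The head's clause C4 (`hbeat`, in closed form `hglob`: `max(η_χ, θ_v^M, θ_w)·Π_{j∉bdry} B_ℓ^{|obs j|} ≤ 1`) relates
four abstract letters.  Here the two letters print gives a currency are WRITTEN IN THAT CURRENCY — the per-vertex small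
factor `θ_v = K_v·x^a` (print: `e^β(L^kε/ε₀)^{1/4−α}`, so `x = L^kε`, `a = 1/4 − α > 0`, `K_v = e^β ε₀^{−a}`) and the
per-leg large factor `B_ℓ = K_B·x^{−m_B}` (print: `|F_{k,loc}(X_{σ_1})| ≦ c(L^kε)^{−m(c)}e^{−m′(c)}` per observable; one
`B_ℓ` per observable leg, `K_B ≥ 1`, `m_B ≥ 0`) — and the sentence *"By performing sufficiently many integrations by
parts …"* becomes a NUMBER: with `n = Σ_{j∉bdry} |obs j|` the total number of interior observable legs (a constant of the
observable `F`, finite family `κ`),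
  `θ_v^M · Π_{j∉bdry} B_ℓ^{|obs j|} = K_v^M K_B^n · x^{aM − m_B n} ≤ 1`
for every `M` with `m_B·n < a·M` — i.e. every `M ≥ M₀ := ⌊m_B n/a⌋₊ + 1` (`lt_of_M0_le`) — as soon as
`x ≤ x₀ := (K_v^M K_B^n)^{−1/(aM − m_B n)}` (`vertexPow_mul_obsPow_le_one`; `eventually_vertexPow_mul_obsPow_le_one`:
for all small `L^kε`).  The other two letters of `s = max(η_χ, θ_v^M, θ_w)` are print's *"extremely small factors"* — the
`χ′`-kind (`η_χ`, p. 309 *"Each t-derivative of a χ-factor in χ_{Λ₁₂^{(k)},t} gives at least a factor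
e^β(L^kε/ε₀)^{1/4−α}"*) and the long-covariance kind (`θ_w`, p. 310 *"The others, localized in region X, have a factor of
e^{−cr(e_k)|X|}"*) — and enter as the two hypotheses `η_χ ≤ θ_v^M`, `θ_w ≤ θ_v^M` (`hglob_of_le`).  §3 is the head theorem
under these currency hypotheses in place of `hglob` (`ineq312_remainder_bdry_currency`).

statement-level skeleton of published theorems with citation tags; proofs where landed; nothing here is a claim
about the Yang–Mills mass gap

PDF held: `paper:balaban1988-cmp114-bij-abelian-higgs-effective-action` (journal page = PDF page + 256); pp. 309, 310,
312 = PDF 53, 54, 56 (x2 renders re-read this session, 2026-08-23).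

CITATION HEADER (lean-in-tree rule).  lit-balaban cell (HOME `run/shared/lean/pub/lit-balaban/`), Phase 2, seat p25
gen 20; row **C2.Claim@312** of `HOME/lit-balaban-r16/ROWS-C2-part2.md` (owner r16, referee ref-5; head theorem of
record `BIJ88WalkIneq312RemainderBdry.ineq312_remainder_bdry` v2.284, USED BY NAME; this file is a MEMBER answering the
HONEST-SCOPE line of `BIJ88WalkIneq312RemainderBeat` — *"whether one `s` beats the product over ALL interior observables
is a strong smallness requirement, stated, not derived"* — in print's currency).  Nothing restated.

## What is proved (0 `sorry`, standard axioms, no new `Prop` facts; theorems only)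

* §1 `vertexPow_mul_obsPow_eq`, **`vertexPow_mul_obsPow_le_one`** (the beat at the explicit threshold `x₀`),
  **`lt_of_M0_le`** (`M₀ = ⌊m_B n/a⌋₊ + 1` integrations by parts suffice), `eventually_vertexPow_mul_obsPow_le_one`,
  `one_le_obsCurrency`, `vertexCurrency_pos`;
* §2 `prod_obsPow_eq_pow_legCount`, `hglob_of_le` (the closed-form clause from the currencies);
* §3 **`ineq312_remainder_bdry_currency`** (the head theorem with `θ_v := K_v x^a`, `B_ℓ := K_B x^{−m_B}`, `M ≥ M₀`-type
  hypothesis `m_B n < a M`, `x ≤ x₀`, `η_χ ≤ θ_v^M`, `θ_w ≤ θ_v^M` in place of `hglob`).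
HONEST SCOPE: (a) `x`, `a`, `m_B`, `K_v`, `K_B` are print's exponents/constants AS LETTERS (print fixes `a = 1/4 − α`; the
dependence of `m(c)`, `m′(c)` on the terms of `F` is the per-leg `m_B`, uniform here); the RELATION between the vertex
currency and the couplings (`hvert`) and everything else of the head's (H1)–(H5) is untouched; (b) the two hypotheses
`η_χ ≤ θ_v^M`, `θ_w ≤ θ_v^M` are print's *"extremely small factors"* sentences, NOT derived (they need the relation between
`e_k`, `r(e_k)`, `p(e_k)` and `L^kε`); (c) the boundary restriction of the head ((H3) as printed) is what keeps `n` = the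
INTERIOR legs only.  NOT summit progress; NOT continuum; NOT Clay.  Imports `BIJ88WalkIneq312RemainderBeat`; modifies
nothing.
-/

noncomputable section

namespace Literature.MathematicalPhysics.QuantumFieldTheory.BalabanImbrieJaffe1984to88.BIJ88WalkRemainderBeatCurrency312

open Classical MeasureTheory Matrix Finset Filter
open scoped BigOperators Topology
open Literature.MathematicalPhysics.QuantumFieldTheory.Balaban1983to89
open B2Eq228Conditioning (weight source)
open BIJ88PolymerRep5134 (corner)
open BIJ88PolymerRep5134Gauss (prec src)
open BIJ88SlotMomentsGauss308 (fieldLaw)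
open BIJ88VertexIbp311 (vexp)
open BIJ88WickDerivatives305 (dlist)
open BIJ88VertexComponents311 (maxArity)
open BIJ88WalkRun311 BIJ88WalkExpansion311 BIJ88WalkRemainderActivity312 BIJ88WalkIneq312Remainder
  BIJ88WalkIneq312RemainderBdry BIJ88WalkIneq312RemainderBeat

/-! ## §1  Print's currencies: the vertex small factor against the observables' large factors -/

section Currency

variable {x a mB Kv KB : ℝ} {M n : ℕ}

/-- bookkeeping in print's currency (`x = L^kε > 0`): `(K_v x^a)^M · (K_B x^{−m_B})^n = K_v^M K_B^n · x^{aM − m_B n}`.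
[cite: BalabanImbrieJaffe1988, §5.14 p.312; p.309] -/
theorem vertexPow_mul_obsPow_eq (hx : 0 < x) :
    (Kv * x ^ a) ^ M * (KB * x ^ (-mB)) ^ n = Kv ^ M * KB ^ n * x ^ (a * M - mB * n) := by
  rw [mul_pow, mul_pow, ← Real.rpow_natCast (x ^ a), ← Real.rpow_natCast (x ^ (-mB)),
    ← Real.rpow_mul hx.le, ← Real.rpow_mul hx.le,
    show a * (M : ℝ) - mB * (n : ℝ) = a * (M : ℝ) + -mB * (n : ℝ) by ring, Real.rpow_add hx]
  ring

/-- **THE BEAT AT THE THRESHOLD** — *"By performing sufficiently many integrations by parts, we have arranged for enough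
small factors to beat these large factors in the remainder terms"*: if `m_B·n < a·M` then for
`0 < x ≤ x₀ := (K_v^M K_B^n)^{−1/(aM − m_B n)}` the `M` vertex factors beat the `n` interior legs:
`(K_v x^a)^M · (K_B x^{−m_B})^n ≤ 1`. [cite: BalabanImbrieJaffe1988, §5.14 p.312] -/
theorem vertexPow_mul_obsPow_le_one (hx : 0 < x) (hKv : 0 < Kv) (hKB : 0 < KB) (hM : mB * n < a * M)
    (hxle : x ≤ (Kv ^ M * KB ^ n) ^ (-(1 / (a * M - mB * n)))) :
    (Kv * x ^ a) ^ M * (KB * x ^ (-mB)) ^ n ≤ 1 := by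
  rw [vertexPow_mul_obsPow_eq hx]
  have he0 : 0 < a * M - mB * n := sub_pos.2 hM
  have hC0 : 0 < Kv ^ M * KB ^ n := mul_pos (pow_pos hKv M) (pow_pos hKB n)
  have h1 : x ^ (a * M - mB * n) ≤ ((Kv ^ M * KB ^ n) ^ (-(1 / (a * M - mB * n)))) ^ (a * M - mB * n) :=
    Real.rpow_le_rpow hx.le hxle he0.le
  rw [← Real.rpow_mul hC0.le, show -(1 / (a * M - mB * n)) * (a * M - mB * n) = -1 by field_simp,
    Real.rpow_neg_one] at h1
  calc Kv ^ M * KB ^ n * x ^ (a * M - mB * n) ≤ Kv ^ M * KB ^ n * (Kv ^ M * KB ^ n)⁻¹ :=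
        mul_le_mul_of_nonneg_left h1 hC0.le
    _ = 1 := mul_inv_cancel₀ hC0.ne'

/-- **"SUFFICIENTLY MANY" IS A NUMBER**: `M₀ := ⌊m_B n / a⌋₊ + 1` integrations by parts (vertex records) per remainder
component suffice — every `M ≥ M₀` has `m_B·n < a·M` (`a > 0`). [cite: BalabanImbrieJaffe1988, §5.14 p.312] -/
theorem lt_of_M0_le (ha : 0 < a) (hM : ⌊mB * n / a⌋₊ + 1 ≤ M) : mB * n < a * M := by
  have h1 : mB * n / a < (⌊mB * n / a⌋₊ : ℝ) + 1 := Nat.lt_floor_add_one _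
  have h2 : (⌊mB * (n : ℝ) / a⌋₊ : ℝ) + 1 ≤ (M : ℝ) := by exact_mod_cast hM
  have h3 : mB * n / a < M := h1.trans_le h2
  rw [div_lt_iff₀ ha] at h3
  linarith [mul_comm (M : ℝ) a]

/-- the beat holds for ALL SMALL `x = L^kε` once `m_B·n < a·M`. [cite: BalabanImbrieJaffe1988, §5.14 p.312] -/
theorem eventually_vertexPow_mul_obsPow_le_one (hKv : 0 < Kv) (hKB : 0 < KB) (hM : mB * n < a * M) :
    ∀ᶠ x in 𝓝[>] (0 : ℝ), (Kv * x ^ a) ^ M * (KB * x ^ (-mB)) ^ n ≤ 1 := by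
  have hx0 : (0 : ℝ) < (Kv ^ M * KB ^ n) ^ (-(1 / (a * M - mB * n))) :=
    Real.rpow_pos_of_pos (mul_pos (pow_pos hKv M) (pow_pos hKB n)) _
  filter_upwards [Ioc_mem_nhdsGT hx0] with x hx
  exact vertexPow_mul_obsPow_le_one hx.1 hKv hKB hM hx.2

/-- the observable currency is a LARGE factor: `K_B x^{−m_B} ≥ 1` for `K_B ≥ 1`, `m_B ≥ 0`, `0 < x ≤ 1`.
[cite: BalabanImbrieJaffe1988, §5.14 p.312] -/
theorem one_le_obsCurrency (hx : 0 < x) (hx1 : x ≤ 1) (hKB : 1 ≤ KB) (hmB : 0 ≤ mB) : 1 ≤ KB * x ^ (-mB) := by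
  have h1 : 1 ≤ x ^ (-mB) := Real.one_le_rpow_of_pos_of_le_one_of_nonpos hx hx1 (neg_nonpos.2 hmB)
  nlinarith

/-- the vertex currency is positive. [cite: BalabanImbrieJaffe1988, p.309] -/
theorem vertexCurrency_pos (hx : 0 < x) (hKv : 0 < Kv) : 0 < Kv * x ^ a := mul_pos hKv (Real.rpow_pos_of_pos hx a)

end Currency

/-! ## §2  The closed-form beating clause from the currencies -/

section Glob

variable {S : Type} {κ : Type}

/-- the interior large factors as ONE power: `Π_{j∉bdry} B_ℓ^{|obs j|} = B_ℓ^n`, `n = Σ_{j∉bdry}|obs j|` the number of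
interior observable legs. [cite: BalabanImbrieJaffe1988, §5.14 p.312] -/
theorem prod_obsPow_eq_pow_legCount [Fintype κ] [DecidableEq κ] (obs : κ → List (S → ℝ)) (Bl : ℝ) (bdry : Finset κ) :
    ∏ j ∈ univ.filter (fun j => j ∉ bdry), Bl ^ (obs j).length =
      Bl ^ (∑ j ∈ univ.filter (fun j => j ∉ bdry), (obs j).length) :=
  Finset.prod_pow_eq_pow_sum _ _ _

/-- the closed-form clause `max(η_χ, t, θ_w)·Π ≤ 1` from `t·Π ≤ 1` when the `χ′`-kind and the long-covariance kind
small factors are below the vertex kind `t = θ_v^M` (print's *"extremely small factors"*).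
[cite: BalabanImbrieJaffe1988, §5.14 p.312; p.309; p.310] -/
theorem hglob_of_le {ηχ θw t Pr : ℝ} (hη : ηχ ≤ t) (hθw : θw ≤ t) (h : t * Pr ≤ 1) :
    max ηχ (max t θw) * Pr ≤ 1 := by
  rwa [max_eq_left hθw, max_eq_right hη]

end Glob

/-! ## §3  The head theorem under the currency hypotheses -/

section Law

variable {ι : Type} [Fintype ι] {κ : Type} [LinearOrder κ] {P : Type} [Fintype P] {β : Type} [DecidableEq β]
variable {α I : Type} [Fintype α] [DecidableEq α] [Fintype I] [DecidableEq I]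
  {blk : α → I} {Δ : Matrix α α ℝ} {ℱ : α → ℝ} {W : Finset I}

/-- **THE HEAD THEOREM OF ROW C2.Claim@312 WITH THE BEATING CLAUSE IN PRINT'S CURRENCY**:
`BIJ88WalkIneq312RemainderBeat.ineq312_remainder_bdry_global` with the per-vertex small factor `θ_v := K_v x^a` and the
per-leg large factor `B_ℓ := K_B x^{−m_B}` (`x = L^kε ∈ (0,1]`, `K_v > 0`, `K_B ≥ 1`, `m_B ≥ 0`, `K_v x^a ≤ 1`),
and the closed-form clause `hglob` REPLACED by: `m_B·n < a·M` (`n = Σ_{j∉bdry}|obs j|`; every `M ≥ ⌊m_B n/a⌋₊ + 1`,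
`lt_of_M0_le`), the threshold `x ≤ (K_v^M K_B^n)^{−1/(aM − m_B n)}`, and `η_χ ≤ θ_v^M`, `θ_w ≤ θ_v^M`.  Conclusion
verbatim the head's: `Ineq312 remSys (remAt/Z) (K_χ Λ_O W_O^{Φ₀(O)}) (Π_{j∈O∩bdry} B_ℓ^{|obs j|}) nfree θ 1`.
[cite: BalabanImbrieJaffe1988, §5.14 p.312 (estimate preceding (5.14.5))] -/
theorem ineq312_remainder_bdry_currency [Fintype κ] (hPD : (prec blk Δ W (corner ℝ W)).PosDef)
    {Cov : P → Matrix {x : α // blk x ∈ W} {x : α // blk x ∈ W} ℝ} {trig : P → Bool} {c : ι → ℝ}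
    {legs : ι → List ({x : α // blk x ∈ W} → ℝ)} {obs : κ → List ({x : α // blk x ∈ W} → ℝ)} {M : ℕ}
    {χ : ({x : α // blk x ∈ W} → ℝ) → ℝ} {oc : κ → Finset β} {vc : ι → Finset β} {reg : P → Finset β}
    {Dir : Set ({x : α // blk x ∈ W} → ℝ)} {B' ρ : P → ℝ} {cV : ι → ℝ} {θ θw ηχ ρ₀ Kχ : ℝ} {Λ : Finset κ → ℝ}
    {N₀ : ℕ} {x a mB Kv KB : ℝ}
    (hx : 0 < x) (hx1 : x ≤ 1) (hKv : 0 < Kv) (hKB : 1 ≤ KB) (hmB : 0 ≤ mB) (hθv1 : Kv * x ^ a ≤ 1)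
    (hθ0 : 0 < θ) (hθ1 : θ ≤ 1) (hB0 : ∀ p, 0 ≤ B' p) (hρ : ∀ p, 0 ≤ ρ p) (hcV0 : ∀ m, 0 ≤ cV m)
    (hη0 : 0 ≤ ηχ) (hθw : 0 < θw)
    (hB : ∀ p, ∀ u ∈ Dir, ∀ w ∈ Dir, |(Cov p *ᵥ u) ⬝ᵥ w| ≤ B' p * ρ p)
    (hBf : ∀ p, ∀ u ∈ Dir, |(Cov p *ᵥ u) ⬝ᵥ src blk ℱ W| ≤ B' p * ρ p)
    (hBz : ∀ p, ∀ u ∈ Dir, ‖Cov p *ᵥ u‖ ≤ B' p * ρ p)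
    (hcV : ∀ m, |c m| ≤ cV m) (hobs : ∀ j, ∀ w ∈ obs j, w ∈ Dir) (hlegs : ∀ m, ∀ w ∈ legs m, w ∈ Dir)
    (hloc : ∀ p, trig p = false → B' p ≤ KB * x ^ (-mB) ∧ reg p = ∅)
    (hwalk : ∀ p, trig p = true → B' p ≤ θw * θ ^ (reg p).card)
    (hvert : ∀ m, cV m * (KB * x ^ (-mB)) ^ (legs m).length ≤ Kv * x ^ a * θ ^ (vc m).card) (hρ₀0 : 0 ≤ ρ₀)
    (hρ₀ : ∀ u ∈ Dir, (∑ p ∈ univ.filter (fun p => Cov p *ᵥ u ≠ 0), ρ p) ≤ ρ₀)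
    (hN : ∀ p, ∀ u ∈ Dir,
      (∑ m, ((range (legs m).length).filter fun j => (Cov p *ᵥ u) ⬝ᵥ (legs m).getD j 0 ≠ 0).card) ≤ N₀)
    (hKχ : 0 ≤ Kχ) (hΛ : ∀ O, 0 ≤ Λ O)
    (hE : ∀ O : Finset κ, ∀ t ∈ expand Cov trig (src blk ℱ W) c legs obs M 0 O, t.consts = 0 →
      |∫ φ, ((t.groups.map fun h => (h.pend : Multiset _)).sum.map fun w => φ ⬝ᵥ w).prod
          * (dlist t.dirs χ φ * vexp c legs φ) ∂(fieldLaw blk Δ ℱ W)|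
        ≤ Kχ * (t.dirs.map fun z => ηχ * ‖z‖).prod * Λ O)
    (bdry : Finset κ)
    (hM : mB * (∑ j ∈ univ.filter (fun j => j ∉ bdry), (obs j).length : ℕ) < a * M)
    (hxle : x ≤ (Kv ^ M * KB ^ (∑ j ∈ univ.filter (fun j => j ∉ bdry), (obs j).length)) ^
      (-(1 / (a * M - mB * (∑ j ∈ univ.filter (fun j => j ∉ bdry), (obs j).length : ℕ)))))
    (hη : ηχ ≤ (Kv * x ^ a) ^ M) (hθw' : θw ≤ (Kv * x ^ a) ^ M) :
    BIJ88Sect5StatementsPart4.Ineq312 (remSys κ β)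
      (fun OX => remAt (prec blk Δ W (corner ℝ W)) Cov trig (src blk ℱ W) c legs obs M χ oc vc reg [] 0 OX.1 OX.2
        / ∫ φ, weight (prec blk Δ W (corner ℝ W)) φ * source (src blk ℱ W) φ)
      (fun OX => Kχ * Λ OX.1 * (max 1 (ρ₀ * ((phi0 legs obs M OX.1 + N₀ : ℕ) : ℝ))) ^ phi0 legs obs M OX.1)
      (fun OX => ∏ j ∈ OX.1.filter (fun j => j ∈ bdry), (KB * x ^ (-mB)) ^ (obs j).length)
      (fun OX => nfreeOf oc OX.2) θ 1 := by
  have hBl : 1 ≤ KB * x ^ (-mB) := one_le_obsCurrency hx hx1 hKB hmB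
  have hθv : 0 < Kv * x ^ a := vertexCurrency_pos hx hKv
  have hη1 : ηχ ≤ 1 := hη.trans (pow_le_one₀ hθv.le hθv1)
  have hθw1 : θw ≤ 1 := hθw'.trans (pow_le_one₀ hθv.le hθv1)
  have hbeat : (Kv * x ^ a) ^ M * ∏ j ∈ univ.filter (fun j => j ∉ bdry), (KB * x ^ (-mB)) ^ (obs j).length ≤ 1 := by
    rw [Finset.prod_pow_eq_pow_sum]
    exact vertexPow_mul_obsPow_le_one hx hKv (zero_lt_one.trans_le hKB) hM hxle
  exact ineq312_remainder_bdry_global (oc := oc) (vc := vc) (reg := reg) (χ := χ) hPD hθ0 hθ1 hBl hB0 hρ hcV0 hη0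
    hη1 hθv hθv1 hθw hθw1 hB hBf hBz hcV hobs hlegs hloc hwalk hvert hρ₀0 hρ₀ hN hKχ hΛ hE bdry
    (hglob_of_le hη hθw' hbeat)

end Law

end Literature.MathematicalPhysics.QuantumFieldTheory.BalabanImbrieJaffe1984to88.BIJ88WalkRemainderBeatCurrency312

end
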